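import Mathlib
import HarnessLib
import Summits.NavierStokesRegularity.NavierStokesRegularity.Theses.RootDecompLeanestSingularity
import Literature.Analysis.FluidPDE.AncientWeakL3BackwardLiouvilleHolds
import Literature.Analysis.FluidPDE.OseenMildUniqueness
import Literature.Analysis.UnboundedOperators.HeatKernelHeatEquation

/-!
# RootDecompLeanestSingularity — support K `NoHollowSpike` (stmt-NavierStokesRegularity-32165) PROVED

Route N10 `route-NavierStokesRegularity-RootDecompLeanestSingularity` (decomp-ns lens-4; writer g3/g4), support
item K of the SPIKE ANATOMY booking (lens-4 g11 `SpikeAnatomy.lean`, critic CLEARED; booked by writer g4 as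
items E `LeanTypeIIEnveloped` 32162 / N `LeanEnvelopedIsTypeI` / F `NoFrozenSpike` / K `NoHollowSpike` 32165 /
S2 `FrozenZoomIsLerayProfile`). The item's docstring: «support · PROVED in the lens file (`noHollowSpike`)».
This file is that port: §6 of the lens file (`zoomInheritsEnvelope`, `backwardWeakL3_of_isEnvelopedFlow`,
`noHollowSpike_of`) with the lens vocabulary (`IsEnveloped`, `zoom`, `IsZoomLimit`, `InOseenClass`,
`IsNontrivialFlow`, `HasHollowSlice`, `IsEnvelopedFlow`) spelled out exactly as in the born decl (no new
definitions), concluded against the route decl BY NAME.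

Content — «inside a weak-`L³` envelope a blow-up core cannot hollow out». For every ENVELOPED Clay blow-up
(maximal smooth Leray–Hopf solution from a rapidly decaying datum whose slices are uniformly bounded in
weak-`L³` on `[0,T)`), no nontrivial zoom limit `U` in the bounded Oseen ancient class (the four standing
hypotheses of `AlbrittonBarker2019_liouville_weakL3_backward`: continuous and bounded on `(−∞,0) × ℝ³`, weakly
divergence-free slices, Oseen integral identity) has a HOLLOW slice (Kato-class caloric extension + vanishing
blow-downs at some `t₀ < 0`). Proof: (S1) a zoom limit of an enveloped solution is an enveloped field — Fatou
for super-level sets under pointwise convergence + the scaling `vol{σ < |λ u(t, x₀ + λν·)|} = (λν)⁻³ vol{σ/λ <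
|u(t)|}`, constant `ν⁻³ M`; hence the uniform weak-`L³` bound along `τ_k = −(k+1) → −∞`; Albritton–Barker 2019
Thm 4.1 (tree, PROVED `AlbrittonBarker2019_liouville_weakL3_backward_holds`) makes `U ≡ 0` up to the hollow
slice; forward uniqueness of bounded Oseen-mild fields (tree, PROVED `oseenMild_bounded_unique`) and slice
continuity make it vanish at all negative times, contradicting nontriviality. Navier–Stokes regularity is NOT
proved by anything here (rung 0): the lineage's residual E `LeanTypeIIEnveloped` (32162) and its siblings stay
open; K closes one of the two exits of N `LeanEnvelopedIsTypeI` (the other, F `NoFrozenSpike`, waits on the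
routine stub S2).

References: AlbrittonBarker2019 arXiv:1811.00502 Thm 4.1; KochNadirashviliSereginSverak2009 arXiv:0709.3599 §4,
(6.2); tree `Literature.Analysis.FluidPDE.AlbrittonBarker2019_liouville_weakL3_backward_holds`,
`Literature.Analysis.FluidPDE.oseenMild_bounded_unique`.
-/
noncomputable section

-- the summit and its single sub-problem share the name (CONVENTIONS §1), as in every Theorems file
set_option linter.dupNamespace false

open MeasureTheory Set Function Filter Topology
open scoped NNReal ENNReal RealInnerProductSpace
open Literature.Analysis Literature.Analysis.FluidPDE

namespace Summit.NavierStokesRegularity.NavierStokesRegularity.Theorems.NoHollowSpike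

/-- **S1 — a zoom limit of an enveloped solution is an enveloped field** (constant `ν⁻³ M`): Fatou for
super-level sets under pointwise convergence + the scaling
`vol{σ < |λ u(t, x₀ + λν·)|} = (λν)⁻³ vol{σ/λ < |u(t)|}`. (Lens `zoomInheritsEnvelope`, with the zoom
`(s, y) ↦ λ · u (t₀ + λ² ν s, x₀ + λ ν y)` written out as in the born decl.) -/
theorem isEnvelopedFlow_of_zoomLimit {ν T : ℝ}
    {u U : ℝ → EuclideanSpace ℝ (Fin 3) → EuclideanSpace ℝ (Fin 3)} (hν : 0 < ν)
    (henv : ∃ M : ℝ≥0∞, M < ⊤ ∧ ∀ t : ℝ, 0 ≤ t → t < T → ∀ σ : ℝ, 0 < σ →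
      ENNReal.ofReal σ ^ 3 * volume {x : EuclideanSpace ℝ (Fin 3) | σ < ‖u t x‖} ≤ M)
    (hzoom : ∃ (tc : ℕ → ℝ) (xc : ℕ → EuclideanSpace ℝ (Fin 3)) (lam : ℕ → ℝ),
      (∀ k, 0 < lam k) ∧ (∀ k, tc k < T) ∧
      (∀ s : ℝ, s < 0 → ∀ᶠ k in Filter.atTop, 0 ≤ tc k + lam k ^ 2 * ν * s) ∧
      ∀ s : ℝ, s < 0 → ∀ y : EuclideanSpace ℝ (Fin 3),
        Filter.Tendsto (fun k => lam k • u (tc k + lam k ^ 2 * ν * s) (xc k + (lam k * ν) • y))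
          Filter.atTop (nhds (U s y))) :
    ∃ M : ℝ≥0∞, M < ⊤ ∧ ∀ t : ℝ, t < 0 → ∀ σ : ℝ, 0 < σ →
      ENNReal.ofReal σ ^ 3 * volume {x : EuclideanSpace ℝ (Fin 3) | σ < ‖U t x‖} ≤ M := by
  obtain ⟨M, hM, hMu⟩ := henv
  obtain ⟨tc, xc, lam, hlam, htc, hev, hconv⟩ := hzoom
  refine ⟨ENNReal.ofReal ((ν ^ 3)⁻¹) * M, ENNReal.mul_lt_top ENNReal.ofReal_lt_top hM, ?_⟩
  intro s hs σ hσ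
  obtain ⟨K₀, hK₀⟩ := eventually_atTop.1 (hev s hs)
  -- the uniform bound on the zoom slices, for `k ≥ K₀`
  have hslice : ∀ k, K₀ ≤ k →
      ENNReal.ofReal σ ^ 3 *
          volume {y : EuclideanSpace ℝ (Fin 3) |
            σ < ‖lam k • u (tc k + lam k ^ 2 * ν * s) (xc k + (lam k * ν) • y)‖} ≤
        ENNReal.ofReal ((ν ^ 3)⁻¹) * M := by
    intro k hk
    have hl : 0 < lam k := hlam k
    have hlν : 0 < lam k * ν := mul_pos hl hν
    have ht'0 : 0 ≤ tc k + lam k ^ 2 * ν * s := hK₀ k hk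
    have ht'T : tc k + lam k ^ 2 * ν * s < T := by
      have h1 : lam k ^ 2 * ν * s < 0 := mul_neg_of_pos_of_neg (by positivity) hs
      linarith [htc k]
    set A : Set (EuclideanSpace ℝ (Fin 3)) :=
      {x | σ / lam k < ‖u (tc k + lam k ^ 2 * ν * s) x‖} with hA
    have hset : {y : EuclideanSpace ℝ (Fin 3) |
          σ < ‖lam k • u (tc k + lam k ^ 2 * ν * s) (xc k + (lam k * ν) • y)‖} =
        (fun y : EuclideanSpace ℝ (Fin 3) => (lam k * ν) • y) ⁻¹'
          ((fun z : EuclideanSpace ℝ (Fin 3) => xc k + z) ⁻¹' A) := by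
      ext y
      simp only [mem_setOf_eq, mem_preimage, hA, norm_smul, Real.norm_eq_abs, abs_of_pos hl]
      rw [div_lt_iff₀ hl, mul_comm]
    have hvol : volume ((fun y : EuclideanSpace ℝ (Fin 3) => (lam k * ν) • y) ⁻¹'
          ((fun z : EuclideanSpace ℝ (Fin 3) => xc k + z) ⁻¹' A)) =
        ENNReal.ofReal |((lam k * ν) ^ 3)⁻¹| * volume A := by
      rw [Measure.addHaar_preimage_smul _ hlν.ne', finrank_euclideanSpace_fin, measure_preimage_add]
    have hreal : σ ^ 3 * |((lam k * ν) ^ 3)⁻¹| = (ν ^ 3)⁻¹ * (σ / lam k) ^ 3 := by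
      rw [abs_of_pos (by positivity)]
      field_simp
    rw [hset, hvol]
    have hσ3 : (0 : ℝ) ≤ σ ^ 3 := pow_nonneg hσ.le 3
    have hν3 : (0 : ℝ) ≤ (ν ^ 3)⁻¹ := inv_nonneg.2 (pow_nonneg hν.le 3)
    have e1 : ENNReal.ofReal σ ^ 3 * ENNReal.ofReal |((lam k * ν) ^ 3)⁻¹| =
        ENNReal.ofReal ((ν ^ 3)⁻¹) * ENNReal.ofReal (σ / lam k) ^ 3 := by
      rw [← ENNReal.ofReal_pow hσ.le, ← ENNReal.ofReal_mul hσ3, hreal, ENNReal.ofReal_mul hν3,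
        ENNReal.ofReal_pow (div_pos hσ hl).le]
    calc ENNReal.ofReal σ ^ 3 * (ENNReal.ofReal |((lam k * ν) ^ 3)⁻¹| * volume A)
        = (ENNReal.ofReal σ ^ 3 * ENNReal.ofReal |((lam k * ν) ^ 3)⁻¹|) * volume A :=
          (mul_assoc _ _ _).symm
      _ = ENNReal.ofReal ((ν ^ 3)⁻¹) * (ENNReal.ofReal (σ / lam k) ^ 3 * volume A) := by
          rw [e1, mul_assoc]
      _ ≤ ENNReal.ofReal ((ν ^ 3)⁻¹) * M :=
          mul_le_mul_right (hMu _ ht'0 ht'T _ (div_pos hσ hl)) _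
  -- Fatou for super-level sets: `{σ < |U s|} ⊆ ⋃_N ⋂_{k ≥ N} {σ < |zoom_k s|}`
  let B : ℕ → Set (EuclideanSpace ℝ (Fin 3)) :=
    fun N => {y | ∀ k, N ≤ k →
      σ < ‖lam k • u (tc k + lam k ^ 2 * ν * s) (xc k + (lam k * ν) • y)‖}
  have hsub : {y : EuclideanSpace ℝ (Fin 3) | σ < ‖U s y‖} ⊆ ⋃ N, B N := by
    intro y hy
    have hev' : ∀ᶠ k in atTop,
        σ < ‖lam k • u (tc k + lam k ^ 2 * ν * s) (xc k + (lam k * ν) • y)‖ :=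
      ((hconv s hs y).norm).eventually_const_lt hy
    obtain ⟨N, hN⟩ := eventually_atTop.1 hev'
    exact mem_iUnion.2 ⟨N, hN⟩
  have hmono : Monotone B := fun N N' hNN' y hy k hk => hy k (hNN'.trans hk)
  have hBN : ∀ N, ENNReal.ofReal σ ^ 3 * volume (B N) ≤ ENNReal.ofReal ((ν ^ 3)⁻¹) * M := by
    intro N
    have hsubN : B N ⊆
        {y : EuclideanSpace ℝ (Fin 3) |
          σ < ‖lam (max N K₀) • u (tc (max N K₀) + lam (max N K₀) ^ 2 * ν * s)
            (xc (max N K₀) + (lam (max N K₀) * ν) • y)‖} := fun y hy => hy _ (le_max_left _ _)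
    exact (mul_le_mul_right (measure_mono hsubN) _).trans (hslice _ (le_max_right _ _))
  calc ENNReal.ofReal σ ^ 3 * volume {y : EuclideanSpace ℝ (Fin 3) | σ < ‖U s y‖}
      ≤ ENNReal.ofReal σ ^ 3 * volume (⋃ N, B N) := mul_le_mul_right (measure_mono hsub) _
    _ = ENNReal.ofReal σ ^ 3 * ⨆ N, volume (B N) := by rw [hmono.measure_iUnion]
    _ = ⨆ N, ENNReal.ofReal σ ^ 3 * volume (B N) := ENNReal.mul_iSup _ _
    _ ≤ ENNReal.ofReal ((ν ^ 3)⁻¹) * M := iSup_le hBN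

/-- An enveloped field has the uniform weak-`L³` bound along the backward times `τ_k = −(k+1)`
(the fifth hypothesis of `AlbrittonBarker2019_liouville_weakL3_backward`). (Lens
`backwardWeakL3_of_isEnvelopedFlow`, with `IsEnvelopedFlow` written out.) -/
theorem backwardWeakL3_of_isEnvelopedFlow
    {U : ℝ → EuclideanSpace ℝ (Fin 3) → EuclideanSpace ℝ (Fin 3)}
    (h : ∃ M : ℝ≥0∞, M < ⊤ ∧ ∀ t : ℝ, t < 0 → ∀ σ : ℝ, 0 < σ →
      ENNReal.ofReal σ ^ 3 * volume {x : EuclideanSpace ℝ (Fin 3) | σ < ‖U t x‖} ≤ M) :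
    ∃ (τ : ℕ → ℝ) (M : ℝ≥0∞), M < ∞ ∧ Tendsto τ atTop atBot ∧ (∀ k, τ k < 0) ∧
      ∀ (k : ℕ) (s : ℝ), 0 < s →
        ENNReal.ofReal s ^ 3 * volume {x : EuclideanSpace ℝ (Fin 3) | s < ‖U (τ k) x‖} ≤ M := by
  obtain ⟨M, hM, hMU⟩ := h
  have hneg : ∀ k : ℕ, -((k : ℝ) + 1) < 0 := fun k => by
    have hk : (0 : ℝ) ≤ k := Nat.cast_nonneg k
    linarith
  refine ⟨fun k => -((k : ℝ) + 1), M, hM, ?_, hneg, fun k s hs => hMU _ (hneg k) s hs⟩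
  exact tendsto_neg_atTop_atBot.comp
    (tendsto_atTop_add_const_right _ _ tendsto_natCast_atTop_atTop)

/-- **Support K `NoHollowSpike` (stmt-NavierStokesRegularity-32165) holds**: the route decl
`Theses.RootDecompLeanestSingularity.NoHollowSpike`. Albritton–Barker 2019 Thm 4.1 (tree, PROVED) makes a
zoom limit with a hollow slice vanish up to that slice (its weak-`L³` hypothesis along `τ_k → −∞` comes from
S1); forward uniqueness of bounded Oseen-mild fields (tree, PROVED `oseenMild_bounded_unique`) and slice
continuity make it vanish at all negative times, contradicting nontriviality. (Lens `noHollowSpike_of` +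
`zoomInheritsEnvelope`, verbatim.) -/
theorem noHollowSpike_proof : Theses.RootDecompLeanestSingularity.NoHollowSpike := by
  intro ν T hν hT u p hmax hLH hdec henv U hzoom hcls hnt hhol
  have hflow := isEnvelopedFlow_of_zoomLimit hν henv hzoom
  obtain ⟨hcont, ⟨C, hC⟩, hdiv, hoseen⟩ := hcls
  obtain ⟨t₀, ht₀, hKato, hblow⟩ := hhol
  -- Albritton–Barker: `U ≡ 0` up to the hollow slice
  have hzero : ∀ t : ℝ, t ≤ t₀ → ∀ x, U t x = 0 :=
    AlbrittonBarker2019_liouville_weakL3_backward_holds hcont ⟨C, hC⟩ hdiv hoseen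
      (backwardWeakL3_of_isEnvelopedFlow hflow) ht₀ hKato hblow
  have hUt₀ : U t₀ = fun _ => 0 := funext fun x => hzero t₀ le_rfl x
  -- forward uniqueness on `(t₀, 0)` against the zero field
  have hM0 : 0 ≤ max C 0 := le_max_right _ _
  have hfwd : ∀ t ∈ Ioo t₀ 0,
      U t =ᵐ[volume] (0 : ℝ → EuclideanSpace ℝ (Fin 3) → EuclideanSpace ℝ (Fin 3)) t :=
    oseenMild_bounded_unique (ν := 1) (s := t₀) (T := 0) (M := max C 0)
      (U := fun _ _ => (0 : EuclideanSpace ℝ (Fin 3))) (u := U) (v := 0) one_pos hM0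
      ((hcont.mono (prod_mono Ioo_subset_Iio_self subset_rfl)).aestronglyMeasurable
        (measurableSet_Ioo.prod MeasurableSet.univ))
      (by exact aestronglyMeasurable_const)
      (fun τ hτ y => (hC τ hτ.2 y).trans (le_max_left _ _))
      (fun τ hτ y => by simp)
      (fun t ht => Eventually.of_forall fun x => by
        rw [hoseen t₀ t ht.1 ht.2 x, hUt₀, UnboundedOperators.heatExtension_zero_fun]
        simp)
      (fun t ht => Eventually.of_forall fun x => by simp)
  obtain ⟨t, ht, x, hx⟩ := hnt
  rcases le_or_gt t t₀ with hle | hlt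
  · exact hx (hzero t hle x)
  · have hae := hfwd t ⟨hlt, ht⟩
    -- the slice `U t` is continuous (the field is continuous on the open slab)
    have hct : Continuous (U t) :=
      hcont.comp_continuous (continuous_const.prodMk continuous_id) fun x => ⟨ht, mem_univ x⟩
    have heq : U t = (0 : ℝ → EuclideanSpace ℝ (Fin 3) → EuclideanSpace ℝ (Fin 3)) t :=
      (hct.ae_eq_iff_eq (μ := volume) continuous_const).1 hae
    exact hx (by rw [heq]; rfl)

end Summit.NavierStokesRegularity.NavierStokesRegularity.Theorems.NoHollowSpike

end
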